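import Literature.AlgebraicGeometry.HodgeTheory.BettiKunnethPiecesJointActionCriteria
import Literature.AlgebraicGeometry.HodgeTheory.BettiKunnethPiecesHardLefschetzReduction
import HarnessLib

/-!
# `HC(T × X)` for EVERY smooth projective threefold `T` and every `n`-fold `X` with `HC(X)`: iff for each `c` with `2 ≤ c`, `2c ≤ n + 3` every triple of morphisms of `ℚ`-Hodge structures
# `φ₃ : H^{2n+3−2c}(X) → H³(T)(c − n)`, (`2c ≤ n + 2`) `φ₂ : H^{2n+2−2c}(X) → H²(T)(c − n)`, (`2c ≤ n + 1`) `φ₁ : H^{2n+1−2c}(X) → H¹(T)(c − n)` is JOINTLY induced by one rational algebraic class of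
# `H^{2c}(T × X)` (Voisin I §11.3.3 Thm. 11.38–11.40, Lemma 11.41, pp. 285–287; §6.2.3 Thm. 6.25, Rem. 6.27; §7.3.1 Def. 7.22, §7.3.2; Thm. 11.30; Voisin II Prop. 9.20; Voisin 2025 §3.2.1)

Family `hodge`, lane `lit-hodgefound` (Track 2 foundations library; Layers A1/A4), layer `Literature/AlgebraicGeometry/HodgeTheory`.  THEOREMS ONLY (no definition, no named fact, no instance;
D-0026 net debt `0`).  The threefold analogue of the seat's g31-#8 (surface × `n`-fold), by the same strong induction on the degree: the pieces of `H^{2c}(T × X)` are `Hⁱ(T) ⊗ H^{2c−i}(X)`,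
`0 ≤ i ≤ 6`; `i = 0` is free (`HC(X)`), `i = 6, 5, 4` reduce by hard Lefschetz on `T` (`L³ : H⁰ ⥲ H⁶`, `L² : H¹ ⥲ H⁵`, `L : H² ⥲ H⁴`) to `i = 0` in degree `2c − 6` and to the pieces `H¹(T) ⊗ H^{2c−5}(X)`,
`H²(T) ⊗ H^{2c−4}(X)` of degrees `2c − 4`, `2c − 2` (settled by induction), and `i = 1, 2, 3` with `2c − i > n` reduce by hard Lefschetz on `X` to degrees `< 2c`.  What is left at level `c` (`2 ≤ c`,
`2c ≤ n + 3`) are the pieces `H³(T) ⊗ H^{2c−3}(X)`, `H²(T) ⊗ H^{2c−2}(X)` (when `2c ≤ n + 2`), `H¹(T) ⊗ H^{2c−1}(X)` (when `2c ≤ n + 1`), i.e. (Lemma 11.41 with integer twists, g31-#2) the morphisms of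
Hodge structures `φ₃ : H^{2n+3−2c}(X) → H³(T)(c − n)`, `φ₂ : H^{2n+2−2c}(X) → H²(T)(c − n)`, `φ₁ : H^{2n+1−2c}(X) → H¹(T)(c − n)`.  For `X = T'` a threefold (`n = 3`): `c = 2` is the triple
`(φ₁₃, φ₂₂, φ₃₁)` and `c = 3` the single `φ₃₃ : H³(T') → H³(T)` of the seat's g31-#7.

WHAT IS PROVED (complex orientations).
* §1 **`BettiUniverse.threefold_tensor_forall_hodgeClasses_algebraic_of_joint_corrAction`** — `HC(X)` and, for `2 ≤ c`, `2c ≤ n + 3`, the joint criterion on the Hodge families of the pieces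
  `j = 2c − 3`, (`2c ≤ n + 2`) `j = 2c − 2`, (`2c ≤ n + 1`) `j = 2c − 1` ⇒ every Hodge class of every `H^{2c}(T × X)` is algebraic.
* §2 **`BettiUniverse.hodgeConjectureFor_threefold_tensor_iff_forall_hom_triple_exists_algebraic`** — the title statement.

THE PRINTS.  C. Voisin (2002) [VoisinHodgeI2002] §6.2.3 Thm. 6.25, Rem. 6.27; §7.3.1 Def. 7.22, Lemma 7.23; §7.3.2; §11.3.1 Thm. 11.30; §11.3.3 Thm. 11.38–11.40, Lemma 11.41 and pp. 285–287.  C. Voisin (2003)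
[VoisinHodgeII2003] §9.2.4 Prop. 9.20 (for divisors, a tree theorem).  C. Voisin (2025) [Voisin2025] §3.2.1 (12)–(14), Prop. 3.8, Cor. 3.9.  P. Deligne (2000/2006) [Deligne2000] §1.

THE OBJECTS (all the tree's).  `BettiUniverse.KunnethSrc`, `BettiUniverse.kunnethSummand`, `BettiUniverse.crossMap`, `BettiUniverse.hodge`, `corrAction complexOrientationFamily`, `HodgeStructure.Hom`, `tateTwist` (`r : ℤ`),
`cast`, `hodgeClasses`, `ofRatClass`, `algebraicClasses`, `HodgeConjectureFor`; the seat's g31-#6 `BettiUniverse.forall_hodgeClasses_algebraic_of_joint_corrAction`, g31-#2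
`…exists_hom_tateTwist_int_of_mem_hodgeClasses_kunnethSummand`, `…exists_mem_hodgeClasses_corrAction_crossMap_eq_ofRatClass_hom_int`, g30-#13 `BettiUniverse.span_range_ofRatClass_eq_top`, the tree's
`…ofRatClass_crossMap_mem_algebraicClasses_of_lefschetzRange/_of_lt/_of_fst_zero/_of_hardLefschetz_left/_of_hardLefschetz_right`, `BettiUniverse.crossMap_mem_hodgeClasses`,
`corrAction_eq_zero_of_mem_kunnethPiece_of_ne`, `ofRatClass_crossMap_mem_kunnethPiece`, `hodgeConjectureFor_iff_of_hodgeModel`, `BettiUniverse.forall_mem_hodgeClasses_hodge_iff`.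

DEVIATIONS / SCOPE.  Complex orientations; `HC(X)` is a hypothesis.  No definitions.

## References
* [VoisinHodgeI2002] C. Voisin, *Hodge Theory and Complex Algebraic Geometry I* (2002) — §6.2.3 Thm. 6.25, Rem. 6.27; §7.3.1 Def. 7.22, Lemma 7.23; §7.3.2; §11.3.1 Thm. 11.30; §11.3.3 Thm. 11.38–11.40, Lemma 11.41, pp. 285–287.
* [VoisinHodgeII2003] C. Voisin, *Hodge Theory and Complex Algebraic Geometry II* (2003) — §9.2.4 Prop. 9.20.
* [Voisin2025] C. Voisin, *Cycle classes on algebraic varieties* (2025) — §3.2.1 (12)–(14), Prop. 3.8, Cor. 3.9.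
* [Deligne2000] P. Deligne, *The Hodge conjecture* (Clay problem description) — §1.

## Provenance
Lane `lit-hodgefound` (Hodge path, Track 2), prover seat `lit-hodgefound-p29` (generation 31), self-proposed row g31-#9 (threefold × arbitrary variety: the joint `Hom_HS` triple criterion in every degree).
-/

noncomputable section

open scoped TensorProduct
open CategoryTheory MonoidalCategory CartesianMonoidalCategory Module Finset
open Literature.AlgebraicTopology.SingularHomology
open Literature.Geometry.Kaehler

namespace Literature.AlgebraicGeometry.HodgeTheory

open Literature.AlgebraicGeometry.Motives
open Literature.AlgebraicGeometry.Motives.HodgeStructure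

variable {n d : ℕ} {T X : SchemeOver ℂ}

variable [HodgeTensorFacts.{0, 0}]

/-! ### §1 All degrees, by strong induction on `c` -/

/-- **Threefold × `n`-fold, all degrees.**  Let `T` be a smooth projective threefold, `X` a smooth projective `n`-fold with `HC(X)`, and suppose that for every `c` with `2 ≤ c`, `2c ≤ n + 3` and every family
`(t_{ij})` of Hodge classes of the Künneth summands of `H^{2c}(T × X)` there is a rational class `γ` with `γ ⊗ 1` algebraic acting on `H^{2n−j}(X;ℂ)` as `crossMap t_{ij} ⊗ 1` for `j = 2c − 3`, for
`j = 2c − 2` when `2c ≤ n + 2`, and for `j = 2c − 1` when `2c ≤ n + 1`.  Then EVERY Hodge class of EVERY `H^{2c}(T × X)` is algebraic (strong induction on `c`; the complement is free by `HC(X)`, hard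
Lefschetz on `T` and on `X`, and g31-#6 applies). [cite: VoisinHodgeI2002, §6.2.3 Thm. 6.25, Rem. 6.27, §11.3.1 Thm. 11.30, §11.3.3 Thm. 11.38–11.40, Lemma 11.41 and pp. 285–287] [cite: VoisinHodgeII2003, §9.2.4 Prop. 9.20]
[cite: Voisin2025, §3.2.1 (12)–(14), Prop. 3.8 and Cor. 3.9] -/
theorem BettiUniverse.threefold_tensor_forall_hodgeClasses_algebraic_of_joint_corrAction (hHD : exists_isReal_hodgeModel) (hT : IsSmoothProjective 3 T) (hX : IsSmoothProjective n X)
    (hTX : IsSmoothProjective d (T ⊗ X)) (hHCX : HodgeConjectureFor n X)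
    (hJ : ∀ c : ℕ, 2 ≤ c → 2 * c ≤ n + 3 → ∀ t : BettiUniverse.KunnethSrc T X (2 * c), (∀ ij, t ij ∈ (BettiUniverse.kunnethSummand hHD hT hX (2 * c) ij).hodgeClasses c) →
      ∃ γ : bettiCohomology (T ⊗ X) (2 * c), ofRatClass (ComplexPoints (T ⊗ X)) (2 * c) γ ∈ algebraicClasses (T ⊗ X) c ∧
        ∀ (i j a : ℕ) (hij : i + j = 2 * c) (_haj : a + j = 2 * n) (hab : a + 2 * c = i + 2 * n), j = 2 * c - 3 ∨ (j = 2 * c - 2 ∧ 2 * c ≤ n + 2) ∨ (j = 2 * c - 1 ∧ 2 * c ≤ n + 1) →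
          corrAction complexOrientationFamily hT hX hab (ofRatClass (ComplexPoints (T ⊗ X)) (2 * c) γ) =
            corrAction complexOrientationFamily hT hX hab (ofRatClass (ComplexPoints (T ⊗ X)) (2 * c) (BettiUniverse.crossMap T X hij (t ⟨(i, j), HasAntidiagonal.mem_antidiagonal.2 hij⟩))))
    (c : ℕ) : ∀ v ∈ (BettiUniverse.hodge hHD hTX (2 * c)).hodgeClasses c, ofRatClass (ComplexPoints (T ⊗ X)) (2 * c) v ∈ algebraicClasses (T ⊗ X) c := by
  have hI := hodgePQ_independent_of_hodgeModel_holds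
  have hHCXc : ∀ c' : ℕ, ∀ x ∈ (BettiUniverse.hodge hHD hX (2 * c')).hodgeClasses c', ofRatClass (ComplexPoints X) (2 * c') x ∈ algebraicClasses X c' :=
    fun c' x hx ↦ hHCX.2 c' _ (isRationalClass_ofRatClass _) ((BettiUniverse.mem_hodgeClasses_hodge_iff_isOfHodgeType hHD hX c' x).1 hx)
  induction c using Nat.strong_induction_on with
  | _ c IH =>
  refine BettiUniverse.forall_hodgeClasses_algebraic_of_joint_corrAction complexOrientationFamily hHD hT hX hTX
    (fun j ↦ 2 ≤ c ∧ 2 * c ≤ n + 3 ∧ (j = 2 * c - 3 ∨ (j = 2 * c - 2 ∧ 2 * c ≤ n + 2) ∨ (j = 2 * c - 1 ∧ 2 * c ≤ n + 1))) (fun i j hij hP u hu ↦ ?_) (fun t ht ↦ ?_)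
  · -- the free complement
    by_cases hc1 : c ≤ 1
    · exact BettiUniverse.ofRatClass_crossMap_mem_algebraicClasses_of_lefschetzRange hHD hT hX hTX hij (Or.inl hc1) hu
    by_cases hi6 : 6 < i
    · exact BettiUniverse.ofRatClass_crossMap_mem_algebraicClasses_of_lt hT hX hij (Or.inl (by omega)) u
    by_cases hj2 : 2 * n < j
    · exact BettiUniverse.ofRatClass_crossMap_mem_algebraicClasses_of_lt hT hX hij (Or.inr hj2) u
    have hi : i ≤ 6 := not_lt.1 hi6
    interval_cases i
    · -- `i = 0`: `HC(X)` in degree `2c`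
      exact BettiUniverse.ofRatClass_crossMap_mem_algebraicClasses_of_fst_zero hHD hT hX hij (hHCXc c) hu
    · -- `i = 1`, `j = 2c − 1 > n`: hard Lefschetz on `X` down to degree `2(n + 1 − c) < 2c`
      have hjn : n < j := by
        by_contra hle
        exact hP ⟨by omega, by omega, Or.inr (Or.inr ⟨by omega, by omega⟩)⟩
      exact BettiUniverse.ofRatClass_crossMap_mem_algebraicClasses_of_hardLefschetz_right hHD hT hX hTX (j₀ := 2 * n - j) (s := j - n) (c₀ := n + 1 - c) (by omega) (by omega) (by omega) hij
        (fun w hw ↦ IH (n + 1 - c) (by omega) _ (BettiUniverse.crossMap_mem_hodgeClasses hHD hI hT hX hTX _ _ hw)) hu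
    · -- `i = 2`, `j = 2c − 2 > n`: down to degree `2(n + 2 − c) < 2c`
      have hjn : n < j := by
        by_contra hle
        exact hP ⟨by omega, by omega, Or.inr (Or.inl ⟨by omega, by omega⟩)⟩
      exact BettiUniverse.ofRatClass_crossMap_mem_algebraicClasses_of_hardLefschetz_right hHD hT hX hTX (j₀ := 2 * n - j) (s := j - n) (c₀ := n + 2 - c) (by omega) (by omega) (by omega) hij
        (fun w hw ↦ IH (n + 2 - c) (by omega) _ (BettiUniverse.crossMap_mem_hodgeClasses hHD hI hT hX hTX _ _ hw)) hu
    · -- `i = 3`, `j = 2c − 3 > n`: down to degree `2(n + 3 − c) < 2c`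
      have hjn : n < j := by
        by_contra hle
        exact hP ⟨by omega, by omega, Or.inl (by omega)⟩
      exact BettiUniverse.ofRatClass_crossMap_mem_algebraicClasses_of_hardLefschetz_right hHD hT hX hTX (j₀ := 2 * n - j) (s := j - n) (c₀ := n + 3 - c) (by omega) (by omega) (by omega) hij
        (fun w hw ↦ IH (n + 3 - c) (by omega) _ (BettiUniverse.crossMap_mem_hodgeClasses hHD hI hT hX hTX _ _ hw)) hu
    · -- `i = 4`: hard Lefschetz on `T` down to the piece `H²(T) ⊗ H^{2c−4}(X)` of degree `2c − 2`
      exact BettiUniverse.ofRatClass_crossMap_mem_algebraicClasses_of_hardLefschetz_left hHD hT hX hTX (i₀ := 2) (s := 1) (c₀ := c - 1) (by omega) (by omega) (by omega) hij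
        (fun w hw ↦ IH (c - 1) (by omega) _ (BettiUniverse.crossMap_mem_hodgeClasses hHD hI hT hX hTX _ _ hw)) hu
    · -- `i = 5`: hard Lefschetz on `T` down to the piece `H¹(T) ⊗ H^{2c−5}(X)` of degree `2c − 4`
      exact BettiUniverse.ofRatClass_crossMap_mem_algebraicClasses_of_hardLefschetz_left hHD hT hX hTX (i₀ := 1) (s := 2) (c₀ := c - 2) (by omega) (by omega) (by omega) hij
        (fun w hw ↦ IH (c - 2) (by omega) _ (BettiUniverse.crossMap_mem_hodgeClasses hHD hI hT hX hTX _ _ hw)) hu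
    · -- `i = 6`: hard Lefschetz on `T` down to `H⁰(T) ⊗ H^{2c−6}(X)`, free by `HC(X)`
      exact BettiUniverse.ofRatClass_crossMap_mem_algebraicClasses_of_hardLefschetz_left hHD hT hX hTX (i₀ := 0) (s := 3) (c₀ := c - 3) (by omega) (by omega) (by omega) hij
        (fun w hw ↦ BettiUniverse.ofRatClass_crossMap_mem_algebraicClasses_of_fst_zero hHD hT hX _ (hHCXc (c - 3)) hw) hu
  · -- the joint criterion on the three pieces
    by_cases hc : 2 ≤ c ∧ 2 * c ≤ n + 3
    · obtain ⟨γ, hγ, hact⟩ := hJ c hc.1 hc.2 t ht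
      exact ⟨γ, hγ, fun i j a hij haj hab hP ↦ hact i j a hij haj hab hP.2.2⟩
    · refine ⟨0, by rw [map_zero]; exact Submodule.zero_mem _, fun i j a hij haj hab hP ↦ absurd ⟨hP.1, hP.2.1⟩ hc⟩

/-! ### §2 The `Hom_HS` triple criterion -/

/-- **`HC(T × X)` for EVERY smooth projective threefold `T` and every smooth projective `n`-fold `X` with `HC(X)` IFF for every `c` with `2 ≤ c`, `2c ≤ n + 3` (`n + r = c`), every morphism of `ℚ`-Hodge
structures `φ₃ : H^{2n+3−2c}(X) → H³(T)(r)`, every `φ₂ : H^{2n+2−2c}(X) → H²(T)(r)` (when `2c ≤ n + 2`) and every `φ₁ : H^{2n+1−2c}(X) → H¹(T)(r)` (when `2c ≤ n + 1`) are JOINTLY induced by a rational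
class `γ ∈ H^{2c}(T × X;ℚ)` with `γ ⊗ 1` algebraic** (complex orientations).  «⇒»: `γ = crossMap t₃ + crossMap t₂ + crossMap t₁` for the Hodge classes with `φ_t = φ` (g31-#2), algebraic by
`HC(T × X)`, each summand acting only on its own degree.  «⇐»: §1. [cite: VoisinHodgeI2002, §7.3.1 Def. 7.22, §7.3.2, §11.3.3 Thm. 11.38–11.40, Lemma 11.41 and pp. 285–287, §6.2.3 Thm. 6.25, §11.3.1 Thm. 11.30]
[cite: Voisin2025, §3.2.1 (12)–(14), Prop. 3.8 and Cor. 3.9] [cite: Deligne2000, §1] -/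
theorem BettiUniverse.hodgeConjectureFor_threefold_tensor_iff_forall_hom_triple_exists_algebraic (hHD : exists_isReal_hodgeModel) (hT : IsSmoothProjective 3 T) (hX : IsSmoothProjective n X)
    (hTX : IsSmoothProjective d (T ⊗ X)) (hHCX : HodgeConjectureFor n X) :
    HodgeConjectureFor d (T ⊗ X) ↔
      ∀ (c : ℕ) (r : ℤ) (_hc2 : 2 ≤ c) (hcn : 2 * c ≤ n + 3) (_hr : ((n : ℕ) : ℤ) + r = ((c : ℕ) : ℤ))
        (φ₃ : HodgeStructure.Hom (BettiUniverse.hodge hHD hX (2 * n + 3 - 2 * c)) (((BettiUniverse.hodge hHD hT 3).tateTwist r).cast (by omega)))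
        (φ₂ : ∀ _h₂ : 2 * c ≤ n + 2, HodgeStructure.Hom (BettiUniverse.hodge hHD hX (2 * n + 2 - 2 * c)) (((BettiUniverse.hodge hHD hT 2).tateTwist r).cast (by omega)))
        (φ₁ : ∀ _h₁ : 2 * c ≤ n + 1, HodgeStructure.Hom (BettiUniverse.hodge hHD hX (2 * n + 1 - 2 * c)) (((BettiUniverse.hodge hHD hT 1).tateTwist r).cast (by omega))),
        ∃ γ : bettiCohomology (T ⊗ X) (2 * c), ofRatClass (ComplexPoints (T ⊗ X)) (2 * c) γ ∈ algebraicClasses (T ⊗ X) c ∧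
          (∀ v, corrAction complexOrientationFamily hT hX (show (2 * n + 3 - 2 * c) + 2 * c = 3 + 2 * n by omega) (ofRatClass (ComplexPoints (T ⊗ X)) (2 * c) γ)
              (ofRatClass (ComplexPoints X) (2 * n + 3 - 2 * c) v) = ofRatClass (ComplexPoints T) 3 (φ₃.toLinearMap v)) ∧
          (∀ (h : 2 * c ≤ n + 2) (w : bettiCohomology X (2 * n + 2 - 2 * c)),
            corrAction complexOrientationFamily hT hX (show (2 * n + 2 - 2 * c) + 2 * c = 2 + 2 * n by omega) (ofRatClass (ComplexPoints (T ⊗ X)) (2 * c) γ)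
              (ofRatClass (ComplexPoints X) (2 * n + 2 - 2 * c) w) = ofRatClass (ComplexPoints T) 2 ((φ₂ h).toLinearMap w)) ∧
          (∀ (h : 2 * c ≤ n + 1) (w : bettiCohomology X (2 * n + 1 - 2 * c)),
            corrAction complexOrientationFamily hT hX (show (2 * n + 1 - 2 * c) + 2 * c = 1 + 2 * n by omega) (ofRatClass (ComplexPoints (T ⊗ X)) (2 * c) γ)
              (ofRatClass (ComplexPoints X) (2 * n + 1 - 2 * c) w) = ofRatClass (ComplexPoints T) 1 ((φ₁ h).toLinearMap w)) := by
  constructor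
  · intro hHC c r hc2 hcn hr φ₃ φ₂ φ₁
    have hall : ∀ v ∈ (BettiUniverse.hodge hHD hTX (2 * c)).hodgeClasses c, ofRatClass (ComplexPoints (T ⊗ X)) (2 * c) v ∈ algebraicClasses (T ⊗ X) c :=
      fun v hv ↦ hHC.2 c _ (isRationalClass_ofRatClass _) ((BettiUniverse.mem_hodgeClasses_hodge_iff_isOfHodgeType hHD hTX c v).1 hv)
    have h3e : 3 + (2 * c - 3) = 2 * c := by omega
    have h2e : 2 + (2 * c - 2) = 2 * c := by omega
    have h1e : 1 + (2 * c - 1) = 2 * c := by omega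
    obtain ⟨t₃, ht₃, h₃⟩ := BettiUniverse.exists_mem_hodgeClasses_corrAction_crossMap_eq_ofRatClass_hom_int hHD hT hX h3e (show (2 * n + 3 - 2 * c) + (2 * c - 3) = 2 * n by omega)
      (show (2 * n + 3 - 2 * c) + 2 * c = 3 + 2 * n by omega) hr (by omega) φ₃
    -- the (possibly absent) pieces `i = 2`, `i = 1`: Hodge classes with the prescribed action, `0` when the piece is not in the criterion
    obtain ⟨t₂, ht₂, h₂⟩ : ∃ t₂ ∈ (BettiUniverse.kunnethSummand hHD hT hX (2 * c) ⟨(2, 2 * c - 2), HasAntidiagonal.mem_antidiagonal.2 h2e⟩).hodgeClasses c,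
        ∀ (h : 2 * c ≤ n + 2) (w : bettiCohomology X (2 * n + 2 - 2 * c)),
          corrAction complexOrientationFamily hT hX (show (2 * n + 2 - 2 * c) + 2 * c = 2 + 2 * n by omega) (ofRatClass (ComplexPoints (T ⊗ X)) (2 * c) (BettiUniverse.crossMap T X h2e t₂))
            (ofRatClass (ComplexPoints X) (2 * n + 2 - 2 * c) w) = ofRatClass (ComplexPoints T) 2 ((φ₂ h).toLinearMap w) := by
      by_cases h : 2 * c ≤ n + 2
      · obtain ⟨t₂, ht₂, h₂⟩ := BettiUniverse.exists_mem_hodgeClasses_corrAction_crossMap_eq_ofRatClass_hom_int hHD hT hX h2e (show (2 * n + 2 - 2 * c) + (2 * c - 2) = 2 * n by omega)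
          (show (2 * n + 2 - 2 * c) + 2 * c = 2 + 2 * n by omega) hr (by omega) (φ₂ h)
        exact ⟨t₂, ht₂, fun _ w ↦ h₂ w⟩
      · exact ⟨0, Submodule.zero_mem _, fun h' ↦ absurd h' h⟩
    obtain ⟨t₁, ht₁, h₁⟩ : ∃ t₁ ∈ (BettiUniverse.kunnethSummand hHD hT hX (2 * c) ⟨(1, 2 * c - 1), HasAntidiagonal.mem_antidiagonal.2 h1e⟩).hodgeClasses c,
        ∀ (h : 2 * c ≤ n + 1) (w : bettiCohomology X (2 * n + 1 - 2 * c)),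
          corrAction complexOrientationFamily hT hX (show (2 * n + 1 - 2 * c) + 2 * c = 1 + 2 * n by omega) (ofRatClass (ComplexPoints (T ⊗ X)) (2 * c) (BettiUniverse.crossMap T X h1e t₁))
            (ofRatClass (ComplexPoints X) (2 * n + 1 - 2 * c) w) = ofRatClass (ComplexPoints T) 1 ((φ₁ h).toLinearMap w) := by
      by_cases h : 2 * c ≤ n + 1
      · obtain ⟨t₁, ht₁, h₁⟩ := BettiUniverse.exists_mem_hodgeClasses_corrAction_crossMap_eq_ofRatClass_hom_int hHD hT hX h1e (show (2 * n + 1 - 2 * c) + (2 * c - 1) = 2 * n by omega)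
          (show (2 * n + 1 - 2 * c) + 2 * c = 1 + 2 * n by omega) hr (by omega) (φ₁ h)
        exact ⟨t₁, ht₁, fun _ w ↦ h₁ w⟩
      · exact ⟨0, Submodule.zero_mem _, fun h' ↦ absurd h' h⟩
    refine ⟨BettiUniverse.crossMap T X h3e t₃ + BettiUniverse.crossMap T X h2e t₂ + BettiUniverse.crossMap T X h1e t₁, ?_, fun v ↦ ?_, fun h w ↦ ?_, fun h w ↦ ?_⟩
    · rw [map_add, map_add]
      exact Submodule.add_mem _ (Submodule.add_mem _ (hall _ (BettiUniverse.crossMap_mem_hodgeClasses hHD hodgePQ_independent_of_hodgeModel_holds hT hX hTX h3e c ht₃))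
        (hall _ (BettiUniverse.crossMap_mem_hodgeClasses hHD hodgePQ_independent_of_hodgeModel_holds hT hX hTX h2e c ht₂)))
        (hall _ (BettiUniverse.crossMap_mem_hodgeClasses hHD hodgePQ_independent_of_hodgeModel_holds hT hX hTX h1e c ht₁))
    · rw [map_add, map_add, map_add, map_add, LinearMap.add_apply, LinearMap.add_apply, h₃ v,
        corrAction_eq_zero_of_mem_kunnethPiece_of_ne complexOrientationFamily hT hX (e := c) (i := 2 * c - 2) (j := 2) h2e (ofRatClass_crossMap_mem_kunnethPiece h2e t₂)
          (show (2 * n + 3 - 2 * c) + 2 * c = 3 + 2 * n by omega) (show (2 * n + 3 - 2 * c) + (2 * c - 2) ≠ 2 * n by omega),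
        corrAction_eq_zero_of_mem_kunnethPiece_of_ne complexOrientationFamily hT hX (e := c) (i := 2 * c - 1) (j := 1) h1e (ofRatClass_crossMap_mem_kunnethPiece h1e t₁)
          (show (2 * n + 3 - 2 * c) + 2 * c = 3 + 2 * n by omega) (show (2 * n + 3 - 2 * c) + (2 * c - 1) ≠ 2 * n by omega), LinearMap.zero_apply, add_zero, add_zero]
    · rw [map_add, map_add, map_add, map_add, LinearMap.add_apply, LinearMap.add_apply, h₂ h w,
        corrAction_eq_zero_of_mem_kunnethPiece_of_ne complexOrientationFamily hT hX (e := c) (i := 2 * c - 3) (j := 3) h3e (ofRatClass_crossMap_mem_kunnethPiece h3e t₃)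
          (show (2 * n + 2 - 2 * c) + 2 * c = 2 + 2 * n by omega) (show (2 * n + 2 - 2 * c) + (2 * c - 3) ≠ 2 * n by omega),
        corrAction_eq_zero_of_mem_kunnethPiece_of_ne complexOrientationFamily hT hX (e := c) (i := 2 * c - 1) (j := 1) h1e (ofRatClass_crossMap_mem_kunnethPiece h1e t₁)
          (show (2 * n + 2 - 2 * c) + 2 * c = 2 + 2 * n by omega) (show (2 * n + 2 - 2 * c) + (2 * c - 1) ≠ 2 * n by omega), LinearMap.zero_apply, zero_add, add_zero]
    · rw [map_add, map_add, map_add, map_add, LinearMap.add_apply, LinearMap.add_apply, h₁ h w,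
        corrAction_eq_zero_of_mem_kunnethPiece_of_ne complexOrientationFamily hT hX (e := c) (i := 2 * c - 3) (j := 3) h3e (ofRatClass_crossMap_mem_kunnethPiece h3e t₃)
          (show (2 * n + 1 - 2 * c) + 2 * c = 1 + 2 * n by omega) (show (2 * n + 1 - 2 * c) + (2 * c - 3) ≠ 2 * n by omega),
        corrAction_eq_zero_of_mem_kunnethPiece_of_ne complexOrientationFamily hT hX (e := c) (i := 2 * c - 2) (j := 2) h2e (ofRatClass_crossMap_mem_kunnethPiece h2e t₂)
          (show (2 * n + 1 - 2 * c) + 2 * c = 1 + 2 * n by omega) (show (2 * n + 1 - 2 * c) + (2 * c - 2) ≠ 2 * n by omega), LinearMap.zero_apply, zero_add, zero_add]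
  · intro h
    have hall : ∀ c, ∀ v ∈ (BettiUniverse.hodge hHD hTX (2 * c)).hodgeClasses c, ofRatClass (ComplexPoints (T ⊗ X)) (2 * c) v ∈ algebraicClasses (T ⊗ X) c := by
      refine BettiUniverse.threefold_tensor_forall_hodgeClasses_algebraic_of_joint_corrAction hHD hT hX hTX hHCX fun c hc2 hcn t ht ↦ ?_
      have h3e : 3 + (2 * c - 3) = 2 * c := by omega
      have h2e : 2 + (2 * c - 2) = 2 * c := by omega
      have h1e : 1 + (2 * c - 1) = 2 * c := by omega
      have hr : ((n : ℕ) : ℤ) + (((c : ℕ) : ℤ) - ((n : ℕ) : ℤ)) = ((c : ℕ) : ℤ) := by omega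
      obtain ⟨φ₃, hφ₃⟩ := BettiUniverse.exists_hom_tateTwist_int_of_mem_hodgeClasses_kunnethSummand hHD hT hX h3e (show (2 * n + 3 - 2 * c) + 2 * c = 3 + 2 * n by omega) hr (by omega)
        (ht ⟨(3, 2 * c - 3), HasAntidiagonal.mem_antidiagonal.2 h3e⟩)
      obtain ⟨ψ₂, hψ₂⟩ := BettiUniverse.exists_hom_tateTwist_int_of_mem_hodgeClasses_kunnethSummand hHD hT hX h2e (show (2 * n + 2 - 2 * c) + 2 * c = 2 + 2 * n by omega) hr (by omega)
        (ht ⟨(2, 2 * c - 2), HasAntidiagonal.mem_antidiagonal.2 h2e⟩)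
      -- the piece `H¹(T) ⊗ H^{2c−1}(X)` enters only when `2c ≤ n + 1`
      have key₁ : ∀ hle : 2 * c ≤ n + 1, ∃ ψ₁ : HodgeStructure.Hom (BettiUniverse.hodge hHD hX (2 * n + 1 - 2 * c)) (((BettiUniverse.hodge hHD hT 1).tateTwist (((c : ℕ) : ℤ) - ((n : ℕ) : ℤ))).cast (by omega)),
          ∀ w, ofRatClass (ComplexPoints T) 1 (ψ₁.toLinearMap w) =
            corrAction complexOrientationFamily hT hX (show (2 * n + 1 - 2 * c) + 2 * c = 1 + 2 * n by omega)
              (ofRatClass (ComplexPoints (T ⊗ X)) (2 * c) (BettiUniverse.crossMap T X h1e (t ⟨(1, 2 * c - 1), HasAntidiagonal.mem_antidiagonal.2 h1e⟩))) (ofRatClass (ComplexPoints X) (2 * n + 1 - 2 * c) w) :=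
        fun hle ↦ BettiUniverse.exists_hom_tateTwist_int_of_mem_hodgeClasses_kunnethSummand hHD hT hX h1e (show (2 * n + 1 - 2 * c) + 2 * c = 1 + 2 * n by omega) hr (by omega)
          (ht ⟨(1, 2 * c - 1), HasAntidiagonal.mem_antidiagonal.2 h1e⟩)
      obtain ⟨γ, hγ, hγ₃, hγ₂, hγ₁⟩ := h c (((c : ℕ) : ℤ) - ((n : ℕ) : ℤ)) hc2 hcn (by omega) φ₃ (fun _ ↦ ψ₂) (fun hle ↦ (key₁ hle).choose)
      refine ⟨γ, hγ, fun i j a hij haj hab hP ↦ ?_⟩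
      rcases hP with rfl | ⟨rfl, hle⟩ | ⟨rfl, hle⟩
      · obtain rfl : i = 3 := by omega
        obtain rfl : a = 2 * n + 3 - 2 * c := by omega
        exact LinearMap.ext_on_range (BettiUniverse.span_range_ofRatClass_eq_top hX (2 * n + 3 - 2 * c)) fun v ↦ by rw [hγ₃ v, hφ₃ v]
      · obtain rfl : i = 2 := by omega
        obtain rfl : a = 2 * n + 2 - 2 * c := by omega
        exact LinearMap.ext_on_range (BettiUniverse.span_range_ofRatClass_eq_top hX (2 * n + 2 - 2 * c)) fun w ↦ by rw [hγ₂ hle w, hψ₂ w]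
      · obtain rfl : i = 1 := by omega
        obtain rfl : a = 2 * n + 1 - 2 * c := by omega
        exact LinearMap.ext_on_range (BettiUniverse.span_range_ofRatClass_eq_top hX (2 * n + 1 - 2 * c)) fun w ↦ by rw [hγ₁ hle w, (key₁ hle).choose_spec w]
    rw [hodgeConjectureFor_iff_of_hodgeModel (BettiUniverse.realHodgeModel hHD hTX)]
    intro c
    rw [← BettiUniverse.forall_mem_hodgeClasses_hodge_iff hHD hTX c]
    exact hall c

end Literature.AlgebraicGeometry.HodgeTheory

end
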